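import Summits.CriticalPhenomena.SAWScalingLimit.Theorems.SAWTwistedSelfEnergyParaMartingaleDefs
import Literature.Probability.RandomPlanarGeometry.ObservableAdapted
import Literature.Probability.RandomPlanarGeometry.DrivingFunctionMeasurable
import Literature.Probability.Process.NaturalFiltrationMartingale
import HarnessLib

/-!
# The capped parafermionic observable along the driving process: bounds, adaptedness, and the
# natural-filtration step of the passage
(crux `SubseqIdentification`, stmt-CriticalPhenomena-0783; line `parafermionic-martingale`, helper of
the split piece S3c `stub_paraPassageAssembly` of the XL passage stub `stub_paraPassage`; stub-worker of
the lead c6)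

The continuum observable of the line is
`N_t(w) = paraObs W w t = exp((5/8)(2 Log w + Log g_t'(w) - 2 Log (g_t(w) - W_t)))` along the chordal
Loewner chain of a continuous driver `W`, capped at the deterministic time `T_w = (Im w)²/16`
(`paraObsCap W w u = paraObs W w (u ∧ T_w)`, `capTimeOf`). The cap keeps every point of the time axis
inside CDHKS's short-time regime `9 t ≤ (Im w)²` (`Loewner.ShortTime`), where the tree's Loewner calculus
gives `‖g_t'(w)‖ ≤ 2`, `g_t'(w) ≠ 0` and `‖g_t(w) - W_t‖ ≥ (2/3) Im w`; hence

* `norm_paraObs_le`, `norm_paraObsCap_le` — the observable is BOUNDED by an explicit constant of `w`,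
  `‖N‖ = (|w|² |g'|/|g - W|²)^{5/8} ≤ exp((5/8)(2 log |w| + log 2 - 2 log (2 Im w/3)))`;
* `measurable_paraObs`, `stronglyAdapted_paraObsCap` — it is a measurable functional of the driving
  path up to the present (`Loewner.measurable_deriv_map`, `Loewner.measurable_map_of_im_pos`), hence
  ADAPTED to every filtration to which `W` is adapted;
* `exists_filtration_martingale_paraObsCap_of_integral_cylinder` — **the natural-filtration step of
  the passage** (para twin of the room line's
  `exists_filtration_martingale_roomObsCap_of_integral_cylinder`, p114096): under a finite measure on
  curve classes with the Borel driving process `W = drivingFunction φ` of a chordal uniformizing map,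
  the COMPLEX cylinder identity `E[(N^w_t - N^w_s) ψ(W_S)] = 0` for all `w ∈ ℍ`, `s ≤ t`, `S_k ≤ s`,
  continuous `|ψ| ≤ 1` makes every capped observable a complex martingale of the natural filtration of
  `W` (`Process.martingale_natural_of_integral_cylinder` on `Re N`, `Im N`, recombined through the
  commutation of the conditional expectation with `Re`, `Im`).

References: D. Chelkak, H. Duminil-Copin, C. Hongler, A. Kemppainen, S. Smirnov, C. R. Math. 352
(2014), §3 (time-limited observables, natural filtration of the driving process); G. F. Lawler,
O. Schramm, W. Werner, Proc. Sympos. Pure Math. 72 (2004), §4.1 (the SLE(8/3) observable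
`(w² g'/(g - W)²)^{5/8}`); G. F. Lawler (2005), §4.1 (`∂_t log g_t' = -2/(g_t - U_t)²`).
-/

noncomputable section

open MeasureTheory Filter Topology Set
open scoped NNReal ENNReal Classical BigOperators
open Literature.Probability.LatticeModels
open Literature.Probability.RandomPlanarGeometry
open UpperHalfPlane (upperHalfPlaneSet)
open scoped PathBorel

namespace Summit.CriticalPhenomena.SAWScalingLimit.Theorems.SubseqIdentification.ParaMartingale

open Summit.CriticalPhenomena.SAWScalingLimit.Theorems.SubseqIdentification.RoomEntropy
  (prefixAt capTimeOf)

/-! ## The cap keeps the short-time regime -/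

/-- Up to the cap `(Im w)²/16` the time is short: `9 (u ∧ T_w) ≤ (Im w)²`. [folklore] -/
theorem nine_mul_min_capTimeOf_le (w : ℂ) (u : ℝ≥0) :
    9 * ((min u (capTimeOf w) : ℝ≥0) : ℝ) ≤ w.im ^ 2 := by
  have hc : ((capTimeOf w : ℝ≥0) : ℝ) = w.im ^ 2 / 16 := Real.coe_toNNReal _ (by positivity)
  have h1 : ((min u (capTimeOf w) : ℝ≥0) : ℝ) ≤ (capTimeOf w : ℝ) :=
    NNReal.coe_le_coe.2 (min_le_right _ _)
  rw [hc] at h1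
  nlinarith [sq_nonneg w.im, ((min u (capTimeOf w) : ℝ≥0)).coe_nonneg]

/-- Up to the cap `(Im w)²/16` every continuous driver is in CDHKS's short-time regime at `w`.
[folklore] -/
theorem shortTime_min_capTimeOf {W : ℝ≥0 → ℝ} (hW : Continuous W) {w : ℂ} (hw : 0 < w.im)
    (u : ℝ≥0) : Loewner.ShortTime W w (min u (capTimeOf w)) :=
  ⟨hW, hw, nine_mul_min_capTimeOf_le w u⟩

/-! ## Boundedness -/

/-- **The observable is bounded in the short-time regime**:
`‖N_t(w)‖ ≤ exp((5/8)(2 log |w| + log 2 - 2 log (2 Im w/3)))` (`‖g'‖ ≤ 2`, `‖g - W‖ ≥ (2/3) Im w`).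
[cite: CDHKSCRAS2014, §3] -/
theorem norm_paraObs_le {W : ℝ≥0 → ℝ} {w : ℂ} {t : ℝ≥0} (h : Loewner.ShortTime W w t) :
    ‖paraObs W w t‖ ≤
      Real.exp (5 / 8 * (2 * Real.log ‖w‖ + Real.log 2 - 2 * Real.log (2 * w.im / 3))) := by
  have hw : 0 < w.im := h.im_pos
  obtain ⟨g, hg⟩ := h.exists_sol
  have hd0 : 0 < ‖deriv (Loewner.map W t) w‖ := by
    rw [h.deriv_map_eq hg]
    exact norm_pos_iff.2 (Complex.exp_ne_zero _)
  have hd2 : ‖deriv (Loewner.map W t) w‖ ≤ 2 := h.norm_deriv_map_le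
  have hG : 2 * w.im / 3 ≤ ‖Loewner.map W t w - W t‖ := h.norm_map_sub_lower
  have hre : ((5 / 8 : ℂ) * (2 * Complex.log w + Complex.log (deriv (Loewner.map W t) w) -
      2 * Complex.log (Loewner.map W t w - W t))).re =
      5 / 8 * (2 * Real.log ‖w‖ + Real.log ‖deriv (Loewner.map W t) w‖ -
        2 * Real.log ‖Loewner.map W t w - W t‖) := by
    have h58 : (5 / 8 : ℂ) = ((5 / 8 : ℝ) : ℂ) := by push_cast; ring
    rw [h58, Complex.re_ofReal_mul]
    simp [Complex.log_re]
  unfold paraObs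
  rw [Complex.norm_exp, hre]
  refine Real.exp_le_exp.2 (mul_le_mul_of_nonneg_left ?_ (by norm_num))
  have h1 : Real.log ‖deriv (Loewner.map W t) w‖ ≤ Real.log 2 := Real.log_le_log hd0 hd2
  have h2 : Real.log (2 * w.im / 3) ≤ Real.log ‖Loewner.map W t w - W t‖ :=
    Real.log_le_log (by positivity) hG
  linarith

/-- **The capped observable is bounded**, for every continuous driver and every time.
[cite: CDHKSCRAS2014, §3] -/
theorem norm_paraObsCap_le {W : ℝ≥0 → ℝ} (hW : Continuous W) {w : ℂ} (hw : 0 < w.im) (u : ℝ≥0) :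
    ‖paraObsCap W w u‖ ≤
      Real.exp (5 / 8 * (2 * Real.log ‖w‖ + Real.log 2 - 2 * Real.log (2 * w.im / 3))) :=
  norm_paraObs_le (shortTime_min_capTimeOf hW hw u)

/-! ## Measurability in the driving path up to the present -/

section Adapted

variable {Ω : Type*} {mΩ : MeasurableSpace Ω} {W : ℝ≥0 → Ω → ℝ}

/-- **The observable at time `t` is a measurable functional of the driving path up to time `t`**
in the short-time regime `9 t ≤ (Im w)²` (`g_t(w)`, `g_t'(w)` are, by `Loewner.measurable_map_of_im_pos`
and `Loewner.measurable_deriv_map`; `Log`, `exp` are measurable). [folklore] -/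
theorem measurable_paraObs (hWc : ∀ ω, Continuous (W · ω)) {t : ℝ≥0}
    (hmeas : ∀ s, s ≤ t → Measurable fun ω ↦ W s ω) {w : ℂ} (hw : 0 < w.im)
    (h9 : 9 * (t : ℝ) ≤ w.im ^ 2) :
    Measurable fun ω ↦ paraObs (fun u ↦ W u ω) w t := by
  have hd : Measurable fun ω ↦ deriv (Loewner.map (fun u ↦ W u ω) t) w :=
    Loewner.measurable_deriv_map hWc hmeas hw h9
  have hm : Measurable fun ω ↦ Loewner.map (fun u ↦ W u ω) t w :=
    Loewner.measurable_map_of_im_pos (W := fun ω u ↦ W u ω) hWc hmeas hw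
  have hWt : Measurable fun ω ↦ ((W t ω : ℝ) : ℂ) := Complex.measurable_ofReal.comp (hmeas t le_rfl)
  unfold paraObs
  exact (((measurable_const.add hd.clog).sub (measurable_const.mul (hm.sub hWt).clog)).const_mul
    _).cexp

/-- **The capped observable is adapted** to every filtration to which the driver (continuous paths)
is adapted: the cap keeps the short-time regime. [folklore] -/
theorem stronglyAdapted_paraObsCap {𝓕 : Filtration ℝ≥0 mΩ} (hWad : StronglyAdapted 𝓕 W)
    (hWc : ∀ ω, Continuous (W · ω)) {w : ℂ} (hw : 0 < w.im) :
    StronglyAdapted 𝓕 fun t ω ↦ paraObsCap (fun u ↦ W u ω) w t := by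
  intro t
  have h9 : 9 * ((min t (capTimeOf w) : ℝ≥0) : ℝ) ≤ w.im ^ 2 := nine_mul_min_capTimeOf_le w t
  exact (measurable_paraObs (mΩ := 𝓕 t) (t := min t (capTimeOf w)) hWc
    (fun s hs ↦ ((hWad s).mono (𝓕.mono (hs.trans (min_le_left _ _)))).measurable) hw
      h9).stronglyMeasurable

end Adapted

/-! ## The natural-filtration step of the passage -/

/-- **From the complex cylinder identity of the capped observables to the martingales of the natural
filtration** (para twin of `exists_filtration_martingale_roomObsCap_of_integral_cylinder`, p114096):
the identity `E_μ[(N^w_t - N^w_s) ψ(W_S)] = 0` for all `w ∈ ℍ`, `s ≤ t`, `S_k ≤ s`, continuous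
`|ψ| ≤ 1` makes every `t ↦ paraObsCap (drivingFunction φ c) w t` a complex martingale of the natural
filtration of `W = drivingFunction φ` (adapted: `stronglyAdapted_paraObsCap`; bounded:
`norm_paraObsCap_le`; `Process.martingale_natural_of_integral_cylinder` for `Re N`, `Im N`, and the
commutation of the conditional expectation with `Re`, `Im`). [cite: CDHKSCRAS2014, §3] -/
theorem exists_filtration_martingale_paraObsCap_of_integral_cylinder
    {D : DobrushinDomain} {φ : ConformalEquiv upperHalfPlaneSet D.carrier}
    {μ : Measure (CurveClass ℂ)} (hφ : D.IsChordalUniformizing φ) [IsFiniteMeasure μ]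
    (h : ∀ w : ℂ, 0 < w.im → ∀ (s t : ℝ≥0), s ≤ t → ∀ (n : ℕ) (S : Fin n → ℝ≥0),
      (∀ k, S k ≤ s) → ∀ ψ : (Fin n → ℝ) → ℝ, Continuous ψ → (∀ v, |ψ v| ≤ 1) →
        ∫ c, (paraObsCap (drivingFunction φ c) w t - paraObsCap (drivingFunction φ c) w s) *
          (ψ (fun k => drivingFunction φ c (S k)) : ℂ) ∂μ = 0) :
    ∃ 𝓕 : Filtration ℝ≥0 (inferInstance : MeasurableSpace (CurveClass ℂ)),
      Adapted 𝓕 (fun t c => drivingFunction φ c t) ∧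
      ∀ w : ℂ, 0 < w.im →
        Martingale (fun t c => paraObsCap (drivingFunction φ c) w t) 𝓕 μ := by
  -- adapted from `exists_filtration_martingale_roomObsCap_of_integral_cylinder` (p114096)
  have hW : ∀ t : ℝ≥0, StronglyMeasurable fun c : CurveClass ℂ ↦ drivingFunction φ c t :=
    fun t ↦ stronglyMeasurable_drivingFunction_apply hφ t
  set 𝓕 : Filtration ℝ≥0 (inferInstance : MeasurableSpace (CurveClass ℂ)) :=
    Filtration.natural (fun (t : ℝ≥0) (c : CurveClass ℂ) ↦ drivingFunction φ c t) hW with h𝓕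
  have hWad : StronglyAdapted 𝓕 fun (t : ℝ≥0) (c : CurveClass ℂ) ↦ drivingFunction φ c t :=
    Filtration.stronglyAdapted_natural hW
  have hWc : ∀ c : CurveClass ℂ, Continuous (drivingFunction φ c) := fun c ↦
    continuous_drivingFunction φ c
  refine ⟨𝓕, hWad.adapted, fun w hw ↦ ?_⟩
  set X : ℝ≥0 → CurveClass ℂ → ℂ := fun t c ↦ paraObsCap (drivingFunction φ c) w t with hX
  have hXad : StronglyAdapted 𝓕 X :=
    stronglyAdapted_paraObsCap (W := fun t c ↦ drivingFunction φ c t) hWad hWc hw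
  have hXb : ∀ t c, ‖X t c‖ ≤
      Real.exp (5 / 8 * (2 * Real.log ‖w‖ + Real.log 2 - 2 * Real.log (2 * w.im / 3))) :=
    fun t c ↦ norm_paraObsCap_le (hWc c) hw t
  have hXint : ∀ t, Integrable (X t) μ := fun t ↦
    Integrable.of_bound ((hXad t).mono (𝓕.le t)).aestronglyMeasurable _ (ae_of_all _ (hXb t))
  -- the real and imaginary parts are martingales of the natural filtration
  have hpart : ∀ L : ℂ →L[ℝ] ℝ, Martingale (fun t c ↦ L (X t c)) 𝓕 μ := by
    intro L
    refine Literature.Probability.Process.martingale_natural_of_integral_cylinder hW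
      (fun t ↦ L.continuous.comp_stronglyMeasurable (hXad t))
      (fun t ↦ L.integrable_comp (hXint t)) fun s t hst n S hS ψ hψc hψ1 ↦ ?_
    have hint : Integrable (fun c ↦ (X t c - X s c) *
        (ψ (fun k ↦ drivingFunction φ c (S k)) : ℂ)) μ := by
      refine Integrable.mul_bdd ((hXint t).sub (hXint s)) ?_ (c := 1) (ae_of_all _ fun c ↦ ?_)
      · exact (Complex.continuous_ofReal.measurable.comp (hψc.measurable.comp
          (measurable_pi_lambda _ fun k ↦ (hW (S k)).measurable))).aestronglyMeasurable
      · rw [Complex.norm_real, Real.norm_eq_abs]; exact hψ1 _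
    have key := h w hw s t hst n S hS ψ hψc hψ1
    have hL := L.integral_comp_comm hint
    rw [key, map_zero] at hL
    rw [← hL]
    refine integral_congr_ae (ae_of_all _ fun c ↦ ?_)
    show (L (X t c) - L (X s c)) * ψ (fun k ↦ drivingFunction φ c (S k)) =
      L ((X t c - X s c) * (ψ (fun k ↦ drivingFunction φ c (S k)) : ℂ))
    rw [mul_comm (X t c - X s c), ← Complex.real_smul, L.map_smul, map_sub, smul_eq_mul, mul_comm]
  refine ⟨hXad, fun s t hst ↦ ?_⟩
  have h1 := Complex.reCLM.comp_condExp_comm (μ := μ) (m := 𝓕 s) (hXint t)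
  have h2 := Complex.imCLM.comp_condExp_comm (μ := μ) (m := 𝓕 s) (hXint t)
  filter_upwards [h1, h2, (hpart Complex.reCLM).2 s t hst, (hpart Complex.imCLM).2 s t hst]
    with c e1 e2 e3 e4
  apply Complex.ext
  · rw [show (μ[X t | 𝓕 s] c).re = (Complex.reCLM ∘ μ[X t | 𝓕 s]) c from rfl, e1]
    exact e3
  · rw [show (μ[X t | 𝓕 s] c).im = (Complex.imCLM ∘ μ[X t | 𝓕 s]) c from rfl, e2]
    exact e4

end Summit.CriticalPhenomena.SAWScalingLimit.Theorems.SubseqIdentification.ParaMartingale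

end
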